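import Summits.HodgeConjecture.HodgeConjecture.Theorems.MarkmanPartnerTransportK3Sq2KugaSatakeMixedPresentation

/-!
# Route MarkmanPartnerTransport · support `PartnerTransport` (stmt-HodgeConjecture-19650) ∕ crux #4 —
# programme «KS-MIXED», step M1 (continued): the MULTIPLIER of a transcendental Hodge map `H²(S) → H²(X)` and the
# transported presentations of `X` on `T(S)_ℚ` and of `S` on `T(X)_ℚ`

Continuation of `…K3Sq2KugaSatakeMixedPresentation` (surface `S` with `h^{2,0} = 1`, marked `K3^{[2]}`-type
fourfold `X`, `g_T : T(S)_ℚ → T(X)_ℚ` the restriction of a rational transcendental Hodge map):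

* `multiplier_pos_of_hom` — an injective Hodge morphism scaling two polarizations by `m` has `m > 0` (second
  Hodge–Riemann relation on `T^{2,0} ≠ 0`);
* `exists_rat_multiplier_SX` — a complex multiplier `q(φ g y, φ g w) = μ ∫_S y ∪ w` on `T(S)_ℂ` is a rational
  multiplier `m ≠ 0` between the polarizations `P = ε∫` of `T(S)_ℚ` and `−q_B|_{T(X)}`;
* `isTranscendentalPartHK_transport_SX` — **THE MIXED PRESENTATION**: `(T(S)_ℚ, m·P, T →g_T→ T(X) ↪ H²_B(X))`
  presents the transcendental part of `X` for the Fujiki form `b` (`IsTranscendentalPartHK`) — the datum at which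
  `IsKSCorrespondenceAlgebraicHK 2` is instantiated in step M4;
* `exists_isTranscendentalPartBetti_transport_XS` — symmetrically, `(T(X)_ℚ, |m'|·Pol, ε', T' →h_T→ T(S) ↪ H²_B(S))`
  presents the transcendental part of `S` (`IsTranscendentalPartBetti`) along a bijective `h_T : T(X)_ℚ → T(S)_ℚ`;
* `exists_homAlg_of_isRationalClass_SX` / `_XS` — RATIONAL algebraic correspondences `S → X` / `X → S` descend to
  Hodge morphisms `T(S)_ℚ → T(X)_ℚ` / `T(X)_ℚ → T(S)_ℚ` (irreducibility, `…MixedPresentation` §0).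

THEOREMS ONLY; no sorry, no definition, no named fact; nothing here says HC or any item is proved. Prover seat
hodge-nonav-19652-p1 (gen 16), `--supports stmt-HodgeConjecture-19650` (blueprint «KS-MIXED»).

References: M. Varesco, Math. Z. 305 (2023) §4 (proof of Thm. 4.5), Cor. 4.6, Def. 1.2, Rem. 2.2; S. Floccari,
arXiv:2210.02948 §5.1; C. Voisin, *Hodge Theory I* §7.1.2; D. Huybrechts, *Lectures on K3 Surfaces* Ch. 3
Lemma 3.1, Cor. 3.3.6; B. van Geemen (2000) §10.1–10.2.
-/

set_option linter.dupNamespace false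

noncomputable section

namespace Summit.HodgeConjecture.HodgeConjecture.Theorems.MarkmanPartnerTransport.KugaSatakeMixed

open scoped TensorProduct
open CategoryTheory MonoidalCategory Literature.AlgebraicGeometry Literature.AlgebraicGeometry.Motives
open Literature.AlgebraicGeometry.HodgeTheory Literature.AlgebraicTopology.SingularHomology
open Literature.AlgebraicGeometry.Motives.HodgeStructure Literature.AlgebraicGeometry.Hyperkaehler
open Literature.AlgebraicGeometry.Surfaces
open Summit.HodgeConjecture.HodgeConjecture.Theorems.OddPrimeSquares
open Summit.HodgeConjecture.HodgeConjecture.Theorems.NikulinTwinTransport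
open Summit.HodgeConjecture.HodgeConjecture.Theorems.MarkmanPartnerTransport.TranscendentalPresentation
open Summit.HodgeConjecture.HodgeConjecture.Theorems.MarkmanPartnerTransport.KugaSatakeSelf
open Summit.HodgeConjecture.HodgeConjecture.Theorems.MarkmanPartnerTransport.KugaSatakePair
open Summit.HodgeConjecture.HodgeConjecture.Theorems.MarkmanPartnerTransport.KugaSatakeHK

variable {S X : SchemeOver ℂ} {φ : complexBetti X 2 ≃ₗ[ℂ] (K3HilbertIndex → ℂ)} {PX : complexBetti X (2 * 4)}
  {z : K3HilbertIndex → ℂ}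

/-- `MarkedK3Sq[X, φ, P, z]`: VERBATIM the `let MarkedK3Sq := …` binder of the route declarations of
MarkmanPartnerTransport (clauses (m1)–(m6)). Local notation only. -/
local notation3 (prettyPrint := false) "MarkedK3Sq[" X ", " φ ", " P ", " z "]" =>
  (((IsIntegralClass P ∧ ∀ Q : complexBetti X (2 * 4), IsIntegralClass Q → ∃ n : ℤ, Q = n • P) ∧
    (∀ c : complexBetti X 2, IsIntegralClass c ↔ ∃ v : K3HilbertIndex → ℤ, φ c = fun i => (v i : ℂ)) ∧
    (∀ a : complexBetti X 2, cupPowTwo a 4 = ((3 : ℂ) * (k3HilbertForm 2 (φ a) (φ a)) ^ 2) • P) ∧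
    (IsOfHodgeType 4 X 2 2 0 (LinearEquiv.symm φ z) ∧
      ∀ τ : complexBetti X 2, IsOfHodgeType 4 X 2 2 0 τ → ∃ t : ℂ, τ = t • LinearEquiv.symm φ z) ∧
    (∀ c : complexBetti X 2, IsOfHodgeType 4 X 2 1 1 c ↔
      (k3HilbertForm 2 (φ c) z = 0 ∧ k3HilbertForm 2 (φ c) (star z) = 0)) ∧
    (k3HilbertForm 2 z z = 0 ∧ 0 < (k3HilbertForm 2 (star z) z).re)))

/-- `H²[hS]`: the weight-two `ℚ`-Hodge structure on `H²(S(ℂ); ℚ)` of the real Hodge model of the surface `S`. -/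
local notation3 "H²[" hS "]" =>
  bettiTwoHodgeStructure hS (BettiUniverse.realHodgeModel exists_isReal_hodgeModel_holds hS)
    (BettiUniverse.realHodgeModel_isHodgeSymmetric exists_isReal_hodgeModel_holds hS)

/-- `T[hS] = T(S)_ℚ = Hdg¹^⊥ ⊆ H²(S(ℂ); ℚ)`. -/
local notation3 "T[" hS "]" =>
  transcendentalLatticeBetti hS (BettiUniverse.realHodgeModel exists_isReal_hodgeModel_holds hS)
    (BettiUniverse.realHodgeModel_isHodgeSymmetric exists_isReal_hodgeModel_holds hS)

/-- `H²_B[hX]`: the weight-two `ℚ`-Hodge structure on `H²(X(ℂ); ℚ)` of the real Hodge model of the fourfold `X`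
(`hX : IsSmoothProjective (2 * 2) X`). -/
local notation3 "H²_B[" hX "]" =>
  bettiTwoHodgeStructureOfModel hX (BettiUniverse.realHodgeModel exists_isReal_hodgeModel_holds hX)
    (BettiUniverse.realHodgeModel_isHodgeSymmetric exists_isReal_hodgeModel_holds hX)

/-- `Θ : ℂ ⊗_ℚ H²(Y(ℂ); ℚ) → H²(Y(ℂ); ℂ)` (`Y = S` or `X`). -/
local notation3 "Θ[" Y "]" => ofRatClassBaseChange (Motives.ComplexPoints Y) (2 * 1)

/-- `ι : H²(Y(ℂ); ℚ) → H²(Y(ℂ); ℂ)`, the rational lattice (`Y = S` or `X`). -/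
local notation3 "ι[" Y "]" => ofRatClass (Motives.ComplexPoints Y) (2 * 1)

/-- `Transc[S, y]`: `y` is cup-orthogonal to `N¹(S) = algebraicClasses S 1`. Local notation only. -/
local notation3 (prettyPrint := false) "Transc[" S ", " y "]" =>
  (∀ d ∈ algebraicClasses S 1, cupProduct (rfl : 2 * 1 + 2 * 1 = 2 * 2) y d = 0)

/-- `BBF[X, φ, y]`: `y` is `q`-orthogonal to `N¹(X) = algebraicClasses X 1` (the route's `IsBBFTransc`). -/
local notation3 (prettyPrint := false) "BBF[" X ", " φ ", " y "]" =>
  (∀ e : complexBetti X 2, e ∈ algebraicClasses X 1 → k3HilbertForm 2 (φ y) (φ e) = 0)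

/-! ### §5 A Hodge morphism scaling two polarizations has a POSITIVE multiplier -/

/-- **Positivity of the multiplier.** Let `H`, `H'` be weight-two Hodge structures with polarizations `P`, `P'`,
`H^{2,0} ≠ 0`, and `f : H → H'` an injective morphism with `P'(f a, f c) = m · P(a, c)`. Then `0 < m`: for
`0 ≠ x ∈ H^{2,0}`, `f_ℂ x ∈ H'^{2,0}` is non-zero and the second Hodge–Riemann relation gives
`−P'_ℂ(f x, \overline{f x}) = m · (−P_ℂ(x, x̄))` with both bracketed quantities positive. [cite: VoisinHodgeI2002, §7.1.2 (Def. 7.3)]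
[cite: Huybrechts2016K3, Ch. 3 Cor. 3.3.6] -/
theorem multiplier_pos_of_hom {V W : Type*} [AddCommGroup V] [Module ℚ V] [AddCommGroup W] [Module ℚ W]
    {H : HodgeStructure V 2} {H' : HodgeStructure W 2} (P : H.Polarization) (P' : H'.Polarization)
    (f : Hom H H') (hf : Function.Injective f.toLinearMap) (h20 : H.piece 2 0 ≠ ⊥) {m : ℚ}
    (hm : ∀ a c : V, P'.form (f.toLinearMap a) (f.toLinearMap c) = m * P.form a c) : 0 < m := by
  obtain ⟨x, hx, hx0⟩ := Submodule.exists_mem_ne_zero_of_ne_bot h20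
  have hfx : f.toLinearMap.baseChange ℂ x ∈ H'.piece 2 0 := f.map_piece_le 2 0 ⟨x, hx, rfl⟩
  have hfx0 : f.toLinearMap.baseChange ℂ x ≠ 0 := fun h =>
    hx0 (Hom.baseChange_injective f hf (by rw [h, map_zero]))
  obtain ⟨r, hr, hrx⟩ := P.pos 2 0 (by norm_num) x hx hx0
  obtain ⟨r', hr', hrx'⟩ := P'.pos 2 0 (by norm_num) _ hfx hfx0
  have hbc : ∀ u v : ℂ ⊗[ℚ] V, P'.form.baseChange ℂ (f.toLinearMap.baseChange ℂ u) (f.toLinearMap.baseChange ℂ v) =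
      (m : ℂ) * P.form.baseChange ℂ u v := by
    intro u v
    induction u using TensorProduct.induction_on with
    | zero => simp only [map_zero, LinearMap.zero_apply, mul_zero]
    | tmul c a =>
      induction v using TensorProduct.induction_on with
      | zero => simp only [map_zero, mul_zero]
      | tmul c' a' =>
        rw [LinearMap.baseChange_tmul, LinearMap.baseChange_tmul, LinearMap.BilinForm.baseChange_tmul,
          LinearMap.BilinForm.baseChange_tmul, hm, Algebra.smul_def, Algebra.smul_def, map_mul, eq_ratCast,
          mul_assoc]
      | add v₁ v₂ h₁ h₂ => rw [map_add, map_add, map_add, h₁, h₂, mul_add]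
    | add u₁ u₂ h₁ h₂ => rw [map_add, map_add, LinearMap.add_apply, map_add, LinearMap.add_apply, h₁, h₂, mul_add]
  have key : ((m : ℚ) : ℂ) * (r : ℂ) = (r' : ℂ) := by
    rw [← hrx, ← hrx', conj_baseChange, hbc]
    ring
  have key' : (m : ℝ) * r = r' := by exact_mod_cast key
  have hmr : (m : ℝ) = r' / r := by rw [eq_div_iff hr.ne']; exact key'
  have hpos : (0 : ℝ) < m := by rw [hmr]; exact div_pos hr' hr
  exact_mod_cast hpos

/-! ### §6 The multiplier of `g` between the two polarizations is rational -/

/-- **A complex multiplier `q(φ g y, φ g w) = μ ∫_S y ∪ w` on `T(S)_ℂ` is a rational multiplier between the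
polarizations.** With `(T, P = ε∫, T ↪ H²_B(S))` presenting `S` (`IsTranscendentalPartBetti`), `(T', −q_B|_{T'},
T' ↪ H²_B(X))` presenting `X` for `b = −q ∘ (φ × φ)` (`IsTranscendentalPartHK`), `g_T : Hom T T'` the restriction
of `g` and `μ ≠ 0`: `Pol(g_T a, g_T c) = m · P(a, c)` on `T` for a rational `m ≠ 0` (`= −μ ε`, a quotient of two
rationals since `P` is non-degenerate on `T ≠ 0`). [cite: Varesco2023, Def. 1.2 and Rem. 2.2]
[cite: Huybrechts2016K3, Ch. 3 Lemma 3.1] -/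
theorem exists_rat_multiplier_SX (hS : IsSmoothProjective 2 S) (hX : IsSmoothProjective (2 * 2) X)
    {T : SubHodgeStructure (H²[hS])} {T' : SubHodgeStructure (H²_B[hX])} (hT : T.toSubmodule = T[hS])
    {P : T.toHodgeStructure.Polarization} {ε : ℤˣ}
    (hj : IsTranscendentalPartBetti hS _ _ T.toHodgeStructure P ε T.subtypeHom) (hT0 : T.toSubmodule ≠ ⊥)
    {b : complexBetti X 2 →ₗ[ℂ] complexBetti X 2 →ₗ[ℂ] ℂ} (hbq : ∀ x y, b x y = -k3HilbertForm 2 (φ x) (φ y))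
    {Pol : T'.toHodgeStructure.Polarization}
    (hj' : IsTranscendentalPartHK hX _ _ b T'.toHodgeStructure Pol T'.subtypeHom)
    {g : complexBetti S (2 * 1) →ₗ[ℂ] complexBetti X 2} {gT : Hom T.toHodgeStructure T'.toHodgeStructure}
    (hgT : ∀ t : T.toSubmodule, ι[X] ((gT.toLinearMap t : T'.toSubmodule) : bettiCohomology X (2 * 1)) =
      g (ι[S] (t : bettiCohomology S (2 * 1))))
    {μ : ℂ} (hμ : μ ≠ 0)
    (hmul : ∀ y w : complexBetti S (2 * 1), Transc[S, y] → Transc[S, w] →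
      k3HilbertForm 2 (φ (g y)) (φ (g w)) = μ * traceC hS (cupProduct (rfl : 2 * 1 + 2 * 1 = 2 * 2) y w)) :
    ∃ m : ℚ, m ≠ 0 ∧ ∀ a c : T.toSubmodule,
      Pol.form (gT.toLinearMap a) (gT.toLinearMap c) = m * P.form a c := by
  have hform := ((isTranscendentalPartBetti_iff hS _ _ _ P ε T.subtypeHom).1 hj).2.2
  have hε2 : ((ε : ℤ) : ℂ) * ((ε : ℤ) : ℂ) = 1 := by
    rw [← Int.cast_mul, ← Units.val_mul, Int.units_mul_self, Units.val_one, Int.cast_one]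
  -- the complex identity on `T(S)_ℚ`
  have key : ∀ a c : T.toSubmodule,
      ((Pol.form (gT.toLinearMap a) (gT.toLinearMap c) : ℚ) : ℂ) = (-(μ * ((ε : ℤ) : ℂ))) * ((P.form a c : ℚ) : ℂ) := by
    intro a c
    have ha : Transc[S, ι[S] (a : bettiCohomology S (2 * 1))] := (mem_transcendental_iff_transc hS _).1 (hT ▸ a.2)
    have hc : Transc[S, ι[S] (c : bettiCohomology S (2 * 1))] := (mem_transcendental_iff_transc hS _).1 (hT ▸ c.2)
    rw [hj'.2.2, SubHodgeStructure.subtypeHom_toLinearMap, Submodule.subtype_apply, Submodule.subtype_apply, hgT, hgT,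
      hbq, hmul _ _ ha hc, hform, SubHodgeStructure.subtypeHom_toLinearMap, Submodule.subtype_apply,
      Submodule.subtype_apply, Rat.cast_mul, algebraMap_cupPairingBetti, Rat.cast_intCast]
    linear_combination (μ * traceC hS (cupProduct (rfl : 2 * 1 + 2 * 1 = 2 * 2) (ι[S] (a : bettiCohomology S (2 * 1)))
      (ι[S] (c : bettiCohomology S (2 * 1))))) * hε2
  -- some `P(a, c) ≠ 0` on `T ≠ 0`
  obtain ⟨a₀, c₀, hac⟩ : ∃ a c : T.toSubmodule, P.form a c ≠ 0 := by
    obtain ⟨a, ha, ha0⟩ := (Submodule.ne_bot_iff _).1 hT0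
    by_contra hall
    push Not at hall
    have h0 : (⟨a, ha⟩ : T.toSubmodule) = 0 := P.nondegenerate.1 _ (fun c => hall ⟨a, ha⟩ c)
    exact ha0 (congrArg Subtype.val h0)
  set q₁ := Pol.form (gT.toLinearMap a₀) (gT.toLinearMap c₀) with hq₁
  set q₂ := P.form a₀ c₀ with hq₂
  have hνq : -(μ * ((ε : ℤ) : ℂ)) = ((q₁ / q₂ : ℚ) : ℂ) := by
    have h := key a₀ c₀
    rw [← hq₁, ← hq₂] at h
    have hq₂' : ((q₂ : ℚ) : ℂ) ≠ 0 := by exact_mod_cast hac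
    rw [Rat.cast_div, eq_div_iff hq₂', h]
  refine ⟨q₁ / q₂, ?_, fun a c => ?_⟩
  · intro h0
    have hε0 : ((ε : ℤ) : ℂ) ≠ 0 := by
      intro h; rw [h, mul_zero] at hε2; exact zero_ne_one hε2
    apply mul_ne_zero hμ hε0
    have h := hνq
    rw [h0, Rat.cast_zero, neg_eq_zero] at h
    exact h
  · have h := key a c
    rw [hνq, ← Rat.cast_mul] at h
    exact_mod_cast h

/-! ### §7 The mixed presentation of the transcendental part of `X` on `T(S)_ℚ` -/

/-- **THE MIXED PRESENTATION.** Let `(T', Pol, T' ↪ H²_B(X))` present the transcendental part of the fourfold `X`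
for the Fujiki form `b` (`IsTranscendentalPartHK`), `P` a polarization of `T ⊆ H²_B(S)`, and `g_T : Hom T T'`
BIJECTIVE with `Pol(g_T a, g_T c) = m · P(a, c)`, `m > 0`. Then `(T, m·P, T →g_T→ T' ↪ H²_B(X))` presents the
transcendental part of `X` as well: the composite is injective with the same image, and
`m P(a, c) = Pol(g_T a, g_T c) = b(g_T a ⊗ 1, g_T c ⊗ 1)`. The presentation at which the Kuga–Satake predicate
of `X` is instantiated (Varesco: the similitude "induces an isomorphism between the Kuga–Satake varieties").
[cite: Varesco2023, §4 (proof of Thm. 4.5) and Cor. 4.6] [cite: Floccari2024, §5.1]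
[cite: vanGeemen2000KugaSatakeHC, §10.1–10.2] -/
theorem isTranscendentalPartHK_transport_SX {n : ℕ} (hX : IsSmoothProjective (2 * n) X)
    {M : HodgeModel (2 * n) X} {hM : M.IsHodgeSymmetric} {b : complexBetti X 2 →ₗ[ℂ] complexBetti X 2 →ₗ[ℂ] ℂ}
    {T' : SubHodgeStructure (bettiTwoHodgeStructureOfModel hX M hM)} {Pol : T'.toHodgeStructure.Polarization}
    (hj' : IsTranscendentalPartHK hX M hM b T'.toHodgeStructure Pol T'.subtypeHom)
    {TT : Type} [AddCommGroup TT] [Module ℚ TT] {H : HodgeStructure TT 2} {P : H.Polarization}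
    {gT : Hom H T'.toHodgeStructure} (hbij : Function.Bijective gT.toLinearMap) {m : ℚ} (hm : 0 < m)
    (hmul : ∀ a c : TT, Pol.form (gT.toLinearMap a) (gT.toLinearMap c) = m * P.form a c) :
    IsTranscendentalPartHK hX M hM b H (P.smul m hm) (T'.subtypeHom.comp gT) := by
  have hr : LinearMap.range (T'.subtypeHom.comp gT).toLinearMap = LinearMap.range T'.subtypeHom.toLinearMap := by
    rw [Hom.comp_toLinearMap, LinearMap.range_comp, LinearMap.range_eq_top.2 hbij.2, Submodule.map_top]
  refine ⟨T'.subtypeHom_injective.comp hbij.1, fun x => ?_, fun t t' => ?_⟩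
  · rw [hr]
    exact hj'.2.1 x
  · rw [Polarization.smul_form_apply, ← hmul, hj'.2.2]
    rfl

/-- **The transported SURFACE presentation** (for the direction `X → S`): with `(T, P = ε∫, T ↪ H²_B(S))`
presenting `S`, `Pol` a polarization of `T' ⊆ H²_B(X)` and `h_T : Hom T' T` BIJECTIVE with
`P(h_T a, h_T c) = m' · Pol(a, c)`, `m' ≠ 0`, the datum `(T', |m'|·Pol, ε', T' →h_T→ T ↪ H²_B(S))` presents the
transcendental part of `S` for the sign `ε' = ε · sign m'`. [cite: Varesco2023, §4 (proof of Thm. 4.5)]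
[cite: vanGeemen2000KugaSatakeHC, §10.1–10.2] -/
theorem exists_isTranscendentalPartBetti_transport_XS (hS : IsSmoothProjective 2 S)
    {T : SubHodgeStructure (H²[hS])} {P : T.toHodgeStructure.Polarization} {ε : ℤˣ}
    (hj : IsTranscendentalPartBetti hS _ _ T.toHodgeStructure P ε T.subtypeHom)
    {TT : Type} [AddCommGroup TT] [Module ℚ TT] {H : HodgeStructure TT 2} {Pol : H.Polarization}
    {hT : Hom H T.toHodgeStructure} (hbij : Function.Bijective hT.toLinearMap) {m' : ℚ} (hm' : m' ≠ 0)
    (hmul : ∀ a c : TT, P.form (hT.toLinearMap a) (hT.toLinearMap c) = m' * Pol.form a c) :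
    ∃ ε' : ℤˣ, IsTranscendentalPartBetti hS _ _ H (Pol.smul |m'| (abs_pos.2 hm')) ε' (T.subtypeHom.comp hT) := by
  obtain ⟨-, hrange, hform⟩ := hj
  have hform' := ((isTranscendentalPartBetti_iff hS _ _ _ P ε T.subtypeHom).1 ⟨T.subtypeHom_injective, hrange, hform⟩).2.2
  have hε2 : ((ε : ℤ) : ℚ) * ((ε : ℤ) : ℚ) = 1 := by
    rw [← Int.cast_mul, ← Units.val_mul, Int.units_mul_self, Units.val_one, Int.cast_one]
  obtain ⟨ε', hε'⟩ : ∃ ε' : ℤˣ, ((ε' : ℤ) : ℚ) * m' = ((ε : ℤ) : ℚ) * |m'| := by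
    rcases lt_or_gt_of_ne hm' with h | h
    · refine ⟨-ε, ?_⟩
      rw [abs_of_neg h, Units.val_neg, Int.cast_neg]
      ring
    · exact ⟨ε, by rw [abs_of_pos h]⟩
  refine ⟨ε', (isTranscendentalPartBetti_iff hS _ _ _ _ ε' _).2 ⟨T.subtypeHom_injective.comp hbij.1, ?_, fun a c => ?_⟩⟩
  · rw [Hom.comp_toLinearMap, LinearMap.range_comp, LinearMap.range_eq_top.2 hbij.2, Submodule.map_top, hrange]
  · rw [Polarization.smul_form_apply]
    change |m'| * Pol.form a c = ((ε' : ℤ) : ℚ) * cupPairingBetti hS (T.subtypeHom.toLinearMap (hT.toLinearMap a))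
      (T.subtypeHom.toLinearMap (hT.toLinearMap c))
    have h1 := hform' (hT.toLinearMap a) (hT.toLinearMap c)
    rw [hmul] at h1
    -- `m' Pol(a,c) = ε ∫ (h a) ∪ (h c)`
    have h2 : cupPairingBetti hS (T.subtypeHom.toLinearMap (hT.toLinearMap a)) (T.subtypeHom.toLinearMap (hT.toLinearMap c)) =
        ((ε : ℤ) : ℚ) * (m' * Pol.form a c) := by
      rw [h1, ← mul_assoc, hε2, one_mul]
    rw [h2]
    linear_combination (-(((ε : ℤ) : ℚ) * Pol.form a c)) * hε' - (|m'| * Pol.form a c) * hε2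

/-! ### §8 Rational correspondences `S → X` and `X → S` descend to Hodge morphisms of the transcendental parts -/

/-- **A RATIONAL algebraic correspondence `[γ]_* : H²(S) → H²(X)` descends to a morphism of Hodge structures
`T(S)_ℚ → T(X)_ℚ`**: for `T ⊆ H²_B(S)` irreducible of K3 type, `T' ⊆ H²_B(X)` the transcendental part, and a rational
algebraic `γ ∈ A^e(X × S)`, there is `a : Hom T T'` with `[γ]_*(t ⊗ 1) = a(t) ⊗ 1` (`[γ]_*` is rational and
type-preserving, hence a Hodge morphism `H²_B(S) → H²_B(X)`, which carries `T` into `T'` by irreducibility,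
`apply_mem_of_isTranscendentalPart_of_irreducible₂`). [cite: VoisinHodgeI2002, §7.3.1, Lemma 7.25 and Lemma 11.41]
[cite: Fulton1998, §16.1] -/
theorem exists_homAlg_of_isRationalClass_SX (hS : IsSmoothProjective 2 S) (hX : IsSmoothProjective (2 * 2) X)
    (T : SubHodgeStructure (H²[hS])) (hirr : T.toHodgeStructure.IsIrreducible) (hK3T : T.toHodgeStructure.IsOfK3Type)
    (T' : SubHodgeStructure (H²_B[hX])) (htr' : (H²_B[hX]).IsTranscendentalPart T')
    {e : ℕ} (hab : 2 * 1 + 2 * e = 2 + 2 * 2)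
    {γ : complexBetti (X ⊗ S) (2 * e)} (hγ : γ ∈ algebraicClasses (X ⊗ S) e) (hγQ : IsRationalClass γ) :
    ∃ a : Hom T.toHodgeStructure T'.toHodgeStructure,
      ∀ t : T.toSubmodule, corrAction complexOrientationFamily hX hS hab γ (ι[S] (t : bettiCohomology S (2 * 1))) =
        ι[X] ((a.toLinearMap t : T'.toSubmodule) : bettiCohomology X (2 * 1)) := by
  set f := corrAction complexOrientationFamily hX hS hab γ with hf
  have hγt : IsOfHodgeType (2 * 2 + 2) (X ⊗ S) (2 * e) e e γ :=
    isOfHodgeType_of_mem_algebraicClasses_of_isSmoothProjective (hX.tensor_holds hS) e hγ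
  have h1 : ∀ y, IsRationalClass y → IsRationalClass (f y) :=
    fun y hy => Arapura2006.isRationalClass_corrAction_complex hX hS hab hγQ hy
  have h2 : ∀ (i j : ℕ) y, IsOfHodgeType 2 S (2 * 1) i j y → IsOfHodgeType 4 X 2 i j (f y) :=
    fun i j y hy => Arapura2006.isOfHodgeType_corrAction_complex hX hS hab hγt (by omega) (by omega) hy
  obtain ⟨G, hG⟩ := exists_hom_ofRatClass_eq_SX hS hX f h1 h2
  have hmem : ∀ t : T.toSubmodule, (G.comp T.subtypeHom).toLinearMap t ∈ T'.toSubmodule := fun t =>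
    apply_mem_of_isTranscendentalPart_of_irreducible₂ hirr (piece_two_zero_ne_bot_of_isOfK3Type hK3T) htr' G t.2
  exact ⟨(G.comp T.subtypeHom).codRestrict T' hmem, fun t => (hG _).symm⟩

/-- **A RATIONAL algebraic correspondence `[γ]_* : H²(X) → H²(S)` descends to a morphism of Hodge structures
`T(X)_ℚ → T(S)_ℚ`**: for `T' ⊆ H²_B(X)` irreducible of K3 type, `T ⊆ H²_B(S)` the transcendental part, and a rational
algebraic `γ ∈ A^e(S × X)`, there is `a : Hom T' T` with `[γ]_*(t' ⊗ 1) = a(t') ⊗ 1`.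
[cite: VoisinHodgeI2002, §7.3.1, Lemma 7.25 and Lemma 11.41] [cite: Fulton1998, §16.1] -/
theorem exists_homAlg_of_isRationalClass_XS (hS : IsSmoothProjective 2 S) (hX : IsSmoothProjective (2 * 2) X)
    (T' : SubHodgeStructure (H²_B[hX])) (hirr' : T'.toHodgeStructure.IsIrreducible)
    (hK3T' : T'.toHodgeStructure.IsOfK3Type)
    (T : SubHodgeStructure (H²[hS])) (htr : (H²[hS]).IsTranscendentalPart T)
    {e : ℕ} (hab : 2 * 1 + 2 * e = 2 * 1 + 2 * 4)
    {γ : complexBetti (S ⊗ X) (2 * e)} (hγ : γ ∈ algebraicClasses (S ⊗ X) e) (hγQ : IsRationalClass γ) :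
    ∃ a : Hom T'.toHodgeStructure T.toHodgeStructure,
      ∀ t' : T'.toSubmodule, corrAction complexOrientationFamily hS hX hab γ (ι[X] (t' : bettiCohomology X (2 * 1))) =
        ι[S] ((a.toLinearMap t' : T.toSubmodule) : bettiCohomology S (2 * 1)) := by
  set f := corrAction complexOrientationFamily hS hX hab γ with hf
  have hγt : IsOfHodgeType (2 + 2 * 2) (S ⊗ X) (2 * e) e e γ :=
    isOfHodgeType_of_mem_algebraicClasses_of_isSmoothProjective (hS.tensor_holds hX) e hγ
  have h1 : ∀ y, IsRationalClass y → IsRationalClass (f y) :=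
    fun y hy => Arapura2006.isRationalClass_corrAction_complex hS hX hab hγQ hy
  have h2 : ∀ (i j : ℕ) y, IsOfHodgeType 4 X 2 i j y → IsOfHodgeType 2 S (2 * 1) i j (f y) :=
    fun i j y hy => Arapura2006.isOfHodgeType_corrAction_complex hS hX hab hγt (by omega) (by omega) hy
  obtain ⟨G, hG⟩ := exists_hom_ofRatClass_eq_XS hS hX f h1 h2
  have hmem : ∀ t' : T'.toSubmodule, (G.comp T'.subtypeHom).toLinearMap t' ∈ T.toSubmodule := fun t' =>
    apply_mem_of_isTranscendentalPart_of_irreducible₂ hirr' (piece_two_zero_ne_bot_of_isOfK3Type hK3T') htr G t'.2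
  exact ⟨(G.comp T'.subtypeHom).codRestrict T hmem, fun t' => (hG _).symm⟩

end Summit.HodgeConjecture.HodgeConjecture.Theorems.MarkmanPartnerTransport.KugaSatakeMixed

end
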